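import Literature.NumberTheory.Sieve.LogIntegral
import Literature.NumberTheory.Sieve.SmoothProfileWeights
import HarnessLib

/-!
# The constants of the twisted profiles `κ_t = κ_{a,ε} e^{−tv}` (bookkeeping for the t-integral)

Topic `Literature/NumberTheory/Sieve`, sub-namespace `ProfileConst`. The estimates
`SmoothBVCore.smoothBV_core`, `SmoothTypeOne.typeOne_bound`, `TypeTwoBound.typeII_bound` are
uniform in the profile `k` through four constants: `K_∞ = sup|k|`, `‖k̂‖₁`, and the Fourier-decay
constants `G` of `k(log r)` and of `(log r) k(log r)`. For the twisted cube profiles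
`κ_t = κ_{a,ε}(v) e^{−tv}` of `SmoothCubeWeights`/`SmoothProfileWeights` (`a ≤ 0`, `0 < ε ≤ 1`,
`t ≥ 0`) all four are `≤ C_{a,ε} (1 + t)³ e^{t(log 2 − a)}`:

* `kappaT_eq_twist` — `κ_t = twist κ_{a,ε} t` (the profile of `LogIntegral`);
* `kC`, `contDiff_kC`, `hasCompactSupport_kC`, `kC_zero_of_pos`, `kappaT_zero_of_nonneg`;
* `abs_kappaT_le_kappaTD` — `K_∞ ≤ (log 2 − a + 3) D_t`;
* `integral_norm_fourier_kC_le` — `‖κ̂_t‖₁ ≤ decInt (log 2 − a + 3) D_t`;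
* `fourier_decay_gOfC`, `fourier_decay_gOfC_twist` — `|𝓕(g)(τ)| ≤ 48 (log 2 − a + 3) D_t e^{−3a} dec₃(τ)`
  for `g = gOfC κ_t` and `g = gOfC (v κ_t)`;

with `D_t = kappaTD a ε t = (1 + K₃) ε^{−3} (1+t)³ e^{t(log 2 − a)}`.

## References

* J. Hinz, Acta Arith. 51 (1988), §2 (the dependence of all constants on the box only through
  `log`-powers). [cite: Hinz1988, §2 p. 178]
-/

noncomputable section

open MeasureTheory Real Set
  Literature.NumberTheory.Sieve.SmoothWeights Literature.NumberTheory.Sieve.SmoothCoset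
  Literature.NumberTheory.Sieve.LogSep Literature.NumberTheory.Sieve.LogIntegral
open scoped FourierTransform

namespace Literature.NumberTheory.Sieve.ProfileConst

/-! ## The profile and its twist -/

/-- `κ_t = twist κ t`. [folklore] -/
theorem kappaT_eq_twist (a ε t : ℝ) : kappaT a ε t = twist (kappa a ε) t := by
  funext v
  show kappa a ε v * Real.exp (-t * v) = kappa a ε v * Real.exp (-(t * v))
  rw [neg_mul]

/-- The complexified profile. [folklore] -/
def kC (a ε t : ℝ) (v : ℝ) : ℂ := (kappaT a ε t v : ℂ)

/-- `kC = ofReal ∘ κ_t`. [folklore] -/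
theorem kC_eq_comp (a ε t : ℝ) : kC a ε t = Complex.ofRealCLM ∘ kappaT a ε t := rfl

/-- `kC` is smooth. [folklore] -/
theorem contDiff_kC (a ε t : ℝ) {n : ℕ∞} : ContDiff ℝ n (kC a ε t) := by
  rw [kC_eq_comp]; exact Complex.ofRealCLM.contDiff.comp (contDiff_kappaT a ε t)

/-- `kC` has compact support (`0 < ε`). [folklore] -/
theorem hasCompactSupport_kC {a ε : ℝ} (hε : 0 < ε) (t : ℝ) : HasCompactSupport (kC a ε t) := by
  rw [kC_eq_comp]; exact (hasCompactSupport_kappaT hε t).comp_left Complex.ofReal_zero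

/-- `κ_t = 0` on `[0, ∞)`. [folklore] -/
theorem kappaT_zero_of_nonneg {a ε : ℝ} (hε : 0 < ε) (t : ℝ) : ∀ v, 0 ≤ v → kappaT a ε t v = 0 :=
  fun _ hv => kappaT_eq_zero_of_ge hε hv

/-- `kC = 0` on `(0, ∞)`. [folklore] -/
theorem kC_zero_of_pos {a ε : ℝ} (hε : 0 < ε) (t : ℝ) : ∀ v, 0 < v → kC a ε t v = 0 := fun v hv => by
  rw [kC, kappaT_eq_zero_of_ge hε hv.le, Complex.ofReal_zero]

/-! ## `K_∞`, `‖κ̂_t‖₁` -/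

/-- `e^{t(log 2 − a)} ≤ (log 2 − a + 3) D_t` (`0 < ε ≤ 1`, `t ≥ 0`, `a ≤ 0`). [folklore] -/
theorem exp_le_kappaTD {a ε t : ℝ} (ha : a ≤ 0) (hε : 0 < ε) (hε1 : ε ≤ 1) (ht : 0 ≤ t) :
    Real.exp (t * (Real.log 2 - a)) ≤ (Real.log 2 - a + 3) * kappaTD a ε t := by
  unfold kappaTD
  have hK := K3_nonneg
  have hl2 := Real.log_pos one_lt_two
  have hE := Real.exp_pos (t * (Real.log 2 - a))
  have h1K : (1 : ℝ) ≤ 1 + K3 := by linarith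
  have hε3 : 1 ≤ (ε ^ 3)⁻¹ := by
    rw [one_le_inv₀ (by positivity)]; exact pow_le_one₀ hε.le hε1
  have ht3 : (1 : ℝ) ≤ (1 + t) ^ 3 := one_le_pow₀ (by linarith)
  have h1 : 1 ≤ (1 + K3) * (ε ^ 3)⁻¹ * (1 + t) ^ 3 :=
    one_le_mul_of_one_le_of_one_le (one_le_mul_of_one_le_of_one_le h1K hε3) ht3
  have h2 : 1 ≤ Real.log 2 - a + 3 := by linarith
  calc Real.exp (t * (Real.log 2 - a)) = 1 * (1 * Real.exp (t * (Real.log 2 - a))) := by ring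
    _ ≤ (Real.log 2 - a + 3) * ((1 + K3) * (ε ^ 3)⁻¹ * (1 + t) ^ 3 * Real.exp (t * (Real.log 2 - a))) :=
        mul_le_mul h2 (mul_le_mul_of_nonneg_right h1 hE.le) (by positivity) (by linarith)

/-- **`|κ_t| ≤ (log 2 − a + 3) D_t`.** [folklore] -/
theorem abs_kappaT_le_kappaTD {a ε t : ℝ} (ha : a ≤ 0) (hε : 0 < ε) (hε1 : ε ≤ 1) (ht : 0 ≤ t) (v : ℝ) :
    |kappaT a ε t v| ≤ (Real.log 2 - a + 3) * kappaTD a ε t :=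
  (abs_kappaT_le ht v).trans (exp_le_kappaTD ha hε hε1 ht)

/-- Iterated derivatives of `kC` are the complexified real ones. [folklore] -/
theorem iteratedDeriv_kC (a ε t : ℝ) (n : ℕ) (v : ℝ) :
    iteratedDeriv n (kC a ε t) v = ((iteratedDeriv n (kappaT a ε t) v : ℝ) : ℂ) := by
  rw [iteratedDeriv_eq_iteratedFDeriv, kC_eq_comp,
    ContinuousLinearMap.iteratedFDeriv_comp_left Complex.ofRealCLM
      ((contDiff_kappaT a ε t (n := ⊤)).contDiffAt (x := v)) (i := n) (by exact_mod_cast le_top),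
    ContinuousLinearMap.compContinuousMultilinearMap_coe, Function.comp_apply, ← iteratedDeriv_eq_iteratedFDeriv]
  rfl

/-- `∫|κ_t^{(n)}| ≤ (log 2 − a) D_t` for `n ≤ 3`. [folklore] -/
theorem integral_norm_iteratedDeriv_kC_le {a ε t : ℝ} (ha : a ≤ 0) (hε : 0 < ε) (hε1 : ε ≤ 1) (ht : 0 ≤ t)
    {n : ℕ} (hn : n ≤ 3) :
    ∫ v, ‖iteratedDeriv n (kC a ε t) v‖ ≤ kappaTD a ε t * (Real.log 2 - a) := by
  have hl2 := Real.log_pos one_lt_two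
  have hbound : ∀ v, ‖iteratedDeriv n (kC a ε t) v‖ ≤ kappaTD a ε t := fun v => by
    rw [iteratedDeriv_kC, Complex.norm_real]
    exact norm_iteratedDeriv_kappaT_le_kappaTD hn a hε hε1 ht v
  have hsupp : Function.support (iteratedDeriv n (kC a ε t)) ⊆ Icc (a - Real.log 2) 0 := by
    intro v hv
    rw [Function.mem_support, iteratedDeriv_kC, Ne, Complex.ofReal_eq_zero] at hv
    by_contra hout
    apply hv
    apply iteratedDeriv_eq_zero_of_notMem_tsupport
    intro hmem
    exact hout (tsupport_kappaT_subset hε t hmem)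
  have hmain := integral_norm_le_of_support (f := iteratedDeriv n (kC a ε t)) (by linarith) hbound hsupp
  calc ∫ v, ‖iteratedDeriv n (kC a ε t) v‖ ≤ kappaTD a ε t * (0 - (a - Real.log 2)) := hmain
    _ = kappaTD a ε t * (Real.log 2 - a) := by ring

/-- **`‖κ̂_t‖₁ ≤ decInt (log 2 − a + 3) D_t`.** [folklore] -/
theorem integral_norm_fourier_kC_le {a ε t : ℝ} (ha : a ≤ 0) (hε : 0 < ε) (hε1 : ε ≤ 1) (ht : 0 ≤ t) :
    ∫ τ, ‖𝓕 (kC a ε t) τ‖ ≤ decInt * ((Real.log 2 - a + 3) * kappaTD a ε t) := by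
  have h := integral_norm_fourier_le (contDiff_kC a ε t) (hasCompactSupport_kC hε t)
  refine h.trans (mul_le_mul_of_nonneg_left ?_ decInt_nonneg)
  have hD := kappaTD_nonneg a hε ht
  have hl2 := Real.log_pos one_lt_two
  have h0 := integral_norm_iteratedDeriv_kC_le ha hε hε1 ht (n := 0) (by norm_num)
  have h2 := integral_norm_iteratedDeriv_kC_le ha hε hε1 ht (n := 2) (by norm_num)
  simp only [iteratedDeriv_zero] at h0
  have hπ1 : (1 : ℝ) ≤ 2 * π := by linarith [Real.pi_gt_three]
  have hπ : (1 : ℝ) ≤ (2 * π) ^ 2 := one_le_pow₀ hπ1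
  have hDL : kappaTD a ε t * (Real.log 2 - a) ≤ (Real.log 2 - a + 3) * kappaTD a ε t := by nlinarith
  refine max_le (h0.trans hDL) ?_
  rw [div_le_iff₀ (by positivity)]
  calc ∫ x, ‖iteratedDeriv 2 (kC a ε t) x‖ ≤ (Real.log 2 - a + 3) * kappaTD a ε t := h2.trans hDL
    _ = (Real.log 2 - a + 3) * kappaTD a ε t * 1 := (mul_one _).symm
    _ ≤ (Real.log 2 - a + 3) * kappaTD a ε t * (2 * π) ^ 2 :=
        mul_le_mul_of_nonneg_left hπ (mul_nonneg (by linarith) hD)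

/-! ## The Fourier decay of `g = gOfC κ_t` and of its `log`-twist -/

/-- Bookkeeping: `max(‖g‖₁, ‖g‴‖₁/(2π)³) ≤ 48 (log 2 − a + 3) D_t e^{−3a}` from the `gfunC` bounds.
[folklore] -/
theorem max_fourier_bound {a ε t : ℝ} (ha : a ≤ 0) (hε : 0 < ε) (ht : 0 ≤ t) {g : ℝ → ℂ}
    (hL1 : ∫ r, ‖g r‖ ≤ kappaTD a ε t) (hL3 : ∫ r, ‖iteratedDeriv 3 g r‖ ≤ 48 * kappaTD a ε t * Real.exp (-3 * a)) :
    max (∫ x, ‖g x‖) ((∫ x, ‖iteratedDeriv 3 g x‖) / (2 * π) ^ 3) ≤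
      48 * ((Real.log 2 - a + 3) * kappaTD a ε t) * Real.exp (-3 * a) := by
  have hD := kappaTD_nonneg a hε ht
  have hl2 := Real.log_pos one_lt_two
  have he3 : 1 ≤ Real.exp (-3 * a) := Real.one_le_exp (by linarith)
  have hπ1 : (1 : ℝ) ≤ 2 * π := by linarith [Real.pi_gt_three]
  have hπ : (1 : ℝ) ≤ (2 * π) ^ 3 := one_le_pow₀ hπ1
  have hLD : kappaTD a ε t ≤ (Real.log 2 - a + 3) * kappaTD a ε t := by nlinarith
  have hLD0 : 0 ≤ (Real.log 2 - a + 3) * kappaTD a ε t := mul_nonneg (by linarith) hD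
  have hRHS : kappaTD a ε t ≤ 48 * ((Real.log 2 - a + 3) * kappaTD a ε t) * Real.exp (-3 * a) := by
    calc kappaTD a ε t = 1 * kappaTD a ε t * 1 := by ring
      _ ≤ 48 * ((Real.log 2 - a + 3) * kappaTD a ε t) * Real.exp (-3 * a) :=
          mul_le_mul (mul_le_mul (by norm_num) hLD hD (by norm_num)) he3 zero_le_one (by positivity)
  refine max_le (hL1.trans hRHS) ?_
  rw [div_le_iff₀ (by positivity)]
  calc ∫ x, ‖iteratedDeriv 3 g x‖ ≤ 48 * kappaTD a ε t * Real.exp (-3 * a) := hL3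
    _ ≤ 48 * ((Real.log 2 - a + 3) * kappaTD a ε t) * Real.exp (-3 * a) := by
        have := Real.exp_pos (-3 * a); nlinarith
    _ = 48 * ((Real.log 2 - a + 3) * kappaTD a ε t) * Real.exp (-3 * a) * 1 := (mul_one _).symm
    _ ≤ 48 * ((Real.log 2 - a + 3) * kappaTD a ε t) * Real.exp (-3 * a) * (2 * π) ^ 3 :=
        mul_le_mul_of_nonneg_left hπ (by positivity)

/-- The same bookkeeping with `‖g‖₁ ≤ (log 2 − a + 3) D_t` and
`‖g‴‖₁ ≤ 48 (log 2 − a + 3) D_t e^{−3a}`. [folklore] -/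
theorem max_fourier_bound' {a ε t : ℝ} (ha : a ≤ 0) (hε : 0 < ε) (ht : 0 ≤ t) {g : ℝ → ℂ}
    (hL1 : ∫ r, ‖g r‖ ≤ (Real.log 2 - a + 3) * kappaTD a ε t)
    (hL3 : ∫ r, ‖iteratedDeriv 3 g r‖ ≤ 48 * ((Real.log 2 - a + 3) * kappaTD a ε t) * Real.exp (-3 * a)) :
    max (∫ x, ‖g x‖) ((∫ x, ‖iteratedDeriv 3 g x‖) / (2 * π) ^ 3) ≤
      48 * ((Real.log 2 - a + 3) * kappaTD a ε t) * Real.exp (-3 * a) := by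
  have hD := kappaTD_nonneg a hε ht
  have hl2 := Real.log_pos one_lt_two
  have he3 : 1 ≤ Real.exp (-3 * a) := Real.one_le_exp (by linarith)
  have hπ1 : (1 : ℝ) ≤ 2 * π := by linarith [Real.pi_gt_three]
  have hπ : (1 : ℝ) ≤ (2 * π) ^ 3 := one_le_pow₀ hπ1
  have hLD0 : 0 ≤ (Real.log 2 - a + 3) * kappaTD a ε t := mul_nonneg (by linarith) hD
  have hRHS : (Real.log 2 - a + 3) * kappaTD a ε t ≤ 48 * ((Real.log 2 - a + 3) * kappaTD a ε t) * Real.exp (-3 * a) := by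
    calc (Real.log 2 - a + 3) * kappaTD a ε t = 1 * ((Real.log 2 - a + 3) * kappaTD a ε t) * 1 := by ring
      _ ≤ 48 * ((Real.log 2 - a + 3) * kappaTD a ε t) * Real.exp (-3 * a) :=
          mul_le_mul (mul_le_mul_of_nonneg_right (by norm_num) hLD0) he3 zero_le_one (by positivity)
  refine max_le (hL1.trans hRHS) ?_
  rw [div_le_iff₀ (by positivity)]
  calc ∫ x, ‖iteratedDeriv 3 g x‖ ≤ 48 * ((Real.log 2 - a + 3) * kappaTD a ε t) * Real.exp (-3 * a) := hL3
    _ = 48 * ((Real.log 2 - a + 3) * kappaTD a ε t) * Real.exp (-3 * a) * 1 := (mul_one _).symm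
    _ ≤ 48 * ((Real.log 2 - a + 3) * kappaTD a ε t) * Real.exp (-3 * a) * (2 * π) ^ 3 :=
        mul_le_mul_of_nonneg_left hπ (by positivity)

/-- **`|𝓕(gOfC κ_t)(τ)| ≤ 48 (log 2 − a + 3) D_t e^{−3a} dec₃(τ)`.** [folklore] -/
theorem fourier_decay_gOfC {a ε t : ℝ} (ha : a ≤ 0) (hε : 0 < ε) (hε1 : ε ≤ 1) (ht : 0 ≤ t) (τ : ℝ) :
    ‖𝓕 (gOfC (kappaT a ε t)) τ‖ ≤ 48 * ((Real.log 2 - a + 3) * kappaTD a ε t) * Real.exp (-3 * a) * dec 3 τ := by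
  obtain ⟨hc, hs, -, -, hL1, hL3⟩ := gfunC_props' (a := a) ha hε hε1 ht
  have h := norm_fourier_le_dec (m := 3) hc hs τ
  refine h.trans (mul_le_mul_of_nonneg_right ?_ (dec_nonneg _ _))
  exact max_fourier_bound ha hε ht hL1 hL3

/-- The `log`-twist `v κ_t(v)` is `kappaTL`. [folklore] -/
theorem mul_kappaT_eq_kappaTL (a ε t : ℝ) : (fun v => v * kappaT a ε t v) = kappaTL a ε t := rfl

/-- **`|𝓕(gOfC (v κ_t))(τ)| ≤ 48 (log 2 − a + 3) D_t e^{−3a} dec₃(τ)`.** [folklore] -/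
theorem fourier_decay_gOfC_twist {a ε t : ℝ} (ha : a ≤ 0) (hε : 0 < ε) (hε1 : ε ≤ 1) (ht : 0 ≤ t) (τ : ℝ) :
    ‖𝓕 (gOfC fun v => v * kappaT a ε t v) τ‖ ≤
      48 * ((Real.log 2 - a + 3) * kappaTD a ε t) * Real.exp (-3 * a) * dec 3 τ := by
  rw [mul_kappaT_eq_kappaTL]
  obtain ⟨hc, hs, -, -, hL1, hL3⟩ := gfunLC_props (a := a) ha hε hε1 ht
  have h := norm_fourier_le_dec (m := 3) hc hs τ
  refine h.trans (mul_le_mul_of_nonneg_right ?_ (dec_nonneg _ _))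
  have hD := kappaTD_nonneg a hε ht
  have hl2 := Real.log_pos one_lt_two
  have hL1' : ∫ r, ‖gOfC (kappaTL a ε t) r‖ ≤ (Real.log 2 - a + 3) * kappaTD a ε t := hL1
  exact max_fourier_bound' ha hε ht hL1' hL3

/-- The `gOfC` data needed by `smoothBV_core`: `C³` and compact support for both profiles. [folklore] -/
theorem gOfC_data {a ε t : ℝ} (ha : a ≤ 0) (hε : 0 < ε) (hε1 : ε ≤ 1) (ht : 0 ≤ t) :
    ContDiff ℝ 3 (gOfC (kappaT a ε t)) ∧ HasCompactSupport (gOfC (kappaT a ε t)) ∧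
      ContDiff ℝ 3 (gOfC fun v => v * kappaT a ε t v) ∧ HasCompactSupport (gOfC fun v => v * kappaT a ε t v) := by
  obtain ⟨hc, hs, -⟩ := gfunC_props' (a := a) ha hε hε1 ht
  obtain ⟨hc', hs', -⟩ := gfunLC_props (a := a) ha hε hε1 ht
  exact ⟨hc, hs, hc', hs'⟩

/-! ## `‖(gOf k)'‖₁` for the profile and its `log`-twist (small-moduli bookkeeping) -/

/-- **`∫|(gOf k)'| ≤ 2 e^{−a} D`** for a smooth profile `k` vanishing off `(a − log 2, 0)` with
`|k'| ≤ D` (`D ≥ 0`). [folklore] -/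
theorem integral_norm_deriv_gOf_le {k : ℝ → ℝ} {a : ℝ} (hk : ContDiff ℝ (⊤ : ℕ∞) k)
    (hlo : ∀ v, v ≤ a - Real.log 2 → k v = 0) (hhi : ∀ v, 0 ≤ v → k v = 0) (ha : a ≤ 0)
    {D : ℝ} (hD : 0 ≤ D) (hk1 : ∀ v, ‖deriv k v‖ ≤ D) :
    ∫ r, ‖deriv (gOf k) r‖ ≤ 2 * Real.exp (-a) * D := by
  have hea : 0 < Real.exp a / 2 := by positivity
  have hlohi : Real.exp a / 2 ≤ 1 := by have := Real.exp_le_one_iff.2 ha; linarith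
  -- the derivative on `r > 0`
  have hderiv : ∀ r, 0 < r → deriv (gOf k) r = deriv k (Real.log r) * r⁻¹ := by
    intro r hr
    have h1 : HasDerivAt (fun s => k (Real.log s)) (deriv k (Real.log r) * r⁻¹) r :=
      hasDerivAt_comp_log (hk.differentiable (by simp)) hr
    exact (h1.congr_of_eventuallyEq (gOf_eventuallyEq_comp k hr)).deriv
  -- support of the derivative
  have hsupp : Function.support (deriv (gOf k)) ⊆ Icc (Real.exp a / 2) 1 := by
    intro r hr
    rw [Function.mem_support] at hr
    by_contra hout
    apply hr
    have hts : r ∉ tsupport (gOf k) := fun h =>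
      hout (closure_minimal (support_gOf_subset hlo hhi) isClosed_Icc h)
    have := iteratedDeriv_eq_zero_of_notMem_tsupport (n := 1) hts
    simpa using this
  -- pointwise bound on the support
  have hbound : ∀ r, ‖deriv (gOf k) r‖ ≤ 2 * Real.exp (-a) * D := by
    intro r
    by_cases hr : r ∈ Function.support (deriv (gOf k))
    · have hmem := hsupp hr
      have hrpos : 0 < r := lt_of_lt_of_le hea hmem.1
      rw [hderiv r hrpos, norm_mul, norm_inv, Real.norm_of_nonneg hrpos.le]
      have hinv : r⁻¹ ≤ 2 * Real.exp (-a) := by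
        rw [inv_le_comm₀ hrpos (by positivity)]
        calc (2 * Real.exp (-a))⁻¹ = Real.exp a / 2 := by rw [Real.exp_neg]; field_simp
          _ ≤ r := hmem.1
      calc ‖deriv k (Real.log r)‖ * r⁻¹ ≤ D * (2 * Real.exp (-a)) :=
            mul_le_mul (hk1 _) hinv (inv_nonneg.2 hrpos.le) hD
        _ = 2 * Real.exp (-a) * D := by ring
    · rw [Function.mem_support, not_not] at hr
      rw [hr, norm_zero]; positivity
  have hC : ∫ r, ‖((deriv (gOf k) r : ℝ) : ℂ)‖ ≤ 2 * Real.exp (-a) * D * (1 - Real.exp a / 2) := by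
    refine integral_norm_le_of_support hlohi (fun r => by rw [Complex.norm_real]; exact hbound r) ?_
    intro r hr
    rw [Function.mem_support, Ne, Complex.ofReal_eq_zero] at hr
    exact hsupp (Function.mem_support.2 hr)
  simp only [Complex.norm_real] at hC
  have h01 : 1 - Real.exp a / 2 ≤ 1 := by linarith
  calc ∫ r, ‖deriv (gOf k) r‖ ≤ 2 * Real.exp (-a) * D * (1 - Real.exp a / 2) := hC
    _ ≤ 2 * Real.exp (-a) * D * 1 := mul_le_mul_of_nonneg_left h01 (by positivity)
    _ = 2 * Real.exp (-a) * D := mul_one _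

/-- **`∫|(gOf κ_t)'| ≤ 2 e^{−a} (log 2 − a + 3) D_t`** and the same for the `log`-twist `v κ_t(v)`.
[folklore] -/
theorem integral_norm_deriv_gOf_kappaT_le {a ε t : ℝ} (ha : a ≤ 0) (hε : 0 < ε) (hε1 : ε ≤ 1) (ht : 0 ≤ t) :
    (∫ r, ‖deriv (gOf (kappaT a ε t)) r‖ ≤ 2 * Real.exp (-a) * ((Real.log 2 - a + 3) * kappaTD a ε t)) ∧
    (∫ r, ‖deriv (gOf fun v => v * kappaT a ε t v) r‖ ≤ 2 * Real.exp (-a) * ((Real.log 2 - a + 3) * kappaTD a ε t)) := by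
  have hD := kappaTD_nonneg a hε ht
  have hl2 := Real.log_pos one_lt_two
  have hD0 : 0 ≤ (Real.log 2 - a + 3) * kappaTD a ε t := mul_nonneg (by linarith) hD
  constructor
  · refine integral_norm_deriv_gOf_le (contDiff_kappaT a ε t) (fun v hv => kappaT_eq_zero_of_le hv)
      (fun v hv => kappaT_eq_zero_of_ge hε hv) ha hD0 fun v => ?_
    have h := norm_iteratedDeriv_kappaT_le_kappaTD (n := 1) (by norm_num) a hε hε1 ht v
    rw [iteratedDeriv_one] at h
    exact h.trans (by nlinarith)
  · rw [mul_kappaT_eq_kappaTL]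
    refine integral_norm_deriv_gOf_le (contDiff_kappaTL a ε t) (fun v hv => kappaTL_eq_zero_of_le hv)
      (fun v hv => kappaTL_eq_zero_of_ge hε hv) ha hD0 fun v => ?_
    have h := norm_iteratedDeriv_kappaTL_le (n := 1) (by norm_num) ha hε hε1 ht v
    rwa [iteratedDeriv_one] at h

end Literature.NumberTheory.Sieve.ProfileConst
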